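import Summits.MatrixMultiplication.OmegaCensus.STPPSmallPatternKernelSearch122
import Summits.MatrixMultiplication.OmegaCensus.STPPSmallPatternKernelReflect

/-!
# ω-census, small STPP pattern `(1,2,2)^k`: kernel search — the difference model and the search invariant

HONEST FRAMING (pub-omega census; verbatim): lottery ticket; floor = certified bounds/negative ranges.
Census STRUCTURE bookkeeping of the STPP track (seat pub-omega-stpp-3, gen 23; STRUCTURE row B5, the threshold column
`T2(H) = max {k : (1,2,2)^k ⊆ H}` — its LOWER sides as kernel theorems), not progress on `ω`: small patterns in small groups
bound no exponent.

First of two reflection files for the engine `STPPSmallPatternKernelSearch122.lean` (`STPP122Neg.search2`), re-using the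
encodings / mask semantics / loop lemmas of the `(2,1,1)` files (`STPPSmallPatternKernel{Bits,Invariant,Reflect}.lean`):
the `(1,2,2)` DIFFERENCE MODEL `ModelD2 b b' c c'` (disjunctive form of the right-hand side of the tree's `exists_isSTPP_122_iff`),
the NORMAL FORM `NF2`, the INVARIANT `InvM2 m S` (the masks `IN, MX, NI, NIM, BS, CS, PB, PC` and the element lists of a state
under-approximate the aggregates of the first `m` triples of a solution), its consequences «the solution's next `b, b', c, c'`
have clear forbidden bits» and «the literal tests pass» (`validNew_true`), and THE CHILD UPDATE `invM2_childSt2`.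

References: H. Cohn, R. Kleinberg, B. Szegedy, C. Umans, FOCS 2005 (arXiv:math/0511460), Def. 5.1.  Record: pub-omega HOME
`pub-omega-stpp-3-g23/` (mirror `k122.py` = lister122 normal-form counts; kernel timing `(1,2,2)³ ⊄ ℤ/23` ≈ 80 s).
-/

namespace Summit.MatrixMultiplication.OmegaCensus

namespace STPP122Neg

open STPP211Neg Literature.Computability.AlgebraicComplexity

section Refl

variable {G : Type} [AddCommGroup G] {E : GEnc G} {K : ℕ} {b b' c c' : Fin K → G}

/-- THE `(1,2,2)` DIFFERENCE MODEL (disjunctive form of the right-hand side of the tree's `exists_isSTPP_122_iff`). -/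
def ModelD2 (b b' c c' : Fin K → G) : Prop :=
  (∀ i, b i ≠ b' i) ∧ (∀ i, c i ≠ c' i) ∧
    (∀ j t t' u u', InA b b' j t → InA b b' j t' → InA c c' j u → InA c c' j u' → t' - u = t - u' → t = t' ∧ u = u') ∧
    (∀ i j l t t' u u', (i ≠ j ∨ l ≠ j) → InA b b' i t → InA b b' j t' → InA c c' j u → InA c c' l u' → t' - u ≠ t - u')

/-- NORMAL FORM: codes of `bᵢ` increasing in `i`, `bᵢ` coded below `b'ᵢ`, `cᵢ` below `c'ᵢ`. -/
def NF2 (E : GEnc G) (b b' c c' : Fin K → G) : Prop :=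
  (∀ i j : Fin K, i < j → E.enc (b i) < E.enc (b j)) ∧ (∀ i, E.enc (b i) < E.enc (b' i)) ∧ (∀ i, E.enc (c i) < E.enc (c' i))

/-- THE INVARIANT of a search state after the first `m` triples of a solution (one-sided mask semantics). -/
structure InvM2 (E : GEnc G) (b b' c c' : Fin K → G) (m : ℕ) (S : St2) : Prop where
  /-- inner differences -/
  hIN : MSub E S.IN fun x => ∃ j : Fin K, j.val < m ∧ ∃ t u, InA b b' j t ∧ InA c c' j u ∧ x = t - u
  /-- mixed differences -/
  hMX : MSub E S.MX fun x => ∃ i l : Fin K, i.val < m ∧ l.val < m ∧ i ≠ l ∧ ∃ t u, InA b b' i t ∧ InA c c' l u ∧ x = t - u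
  /-- negated inner differences -/
  hNI : MSub E S.NI fun x => ∃ j : Fin K, j.val < m ∧ ∃ t u, InA b b' j t ∧ InA c c' j u ∧ x = u - t
  /-- negated inner and mixed differences -/
  hNIM : MSub E S.NIM fun x => ∃ i l : Fin K, i.val < m ∧ l.val < m ∧ ∃ t u, InA b b' i t ∧ InA c c' l u ∧ x = u - t
  /-- `B`-elements -/
  hBS : MSub E S.BS fun x => ∃ i : Fin K, i.val < m ∧ InA b b' i x
  /-- `C`-elements -/
  hCS : MSub E S.CS fun x => ∃ l : Fin K, l.val < m ∧ InA c c' l x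
  /-- forbidden `b` -/
  hPB : MSub E S.PB fun x => ∃ j l : Fin K, j.val < m ∧ l.val < m ∧ ∃ t u u', InA b b' j t ∧ InA c c' j u ∧ InA c c' l u' ∧
    x = t - u + u'
  /-- forbidden `c` -/
  hPC : MSub E S.PC fun x => ∃ j i : Fin K, j.val < m ∧ i.val < m ∧ ∃ t u t', InA b b' j t ∧ InA c c' j u ∧ InA b b' i t' ∧
    x = t' - (t - u)
  /-- the list of old `B`-codes -/
  hbs : ∀ x ∈ S.bs, ∃ i : Fin K, i.val < m ∧ ∃ t, InA b b' i t ∧ x = E.enc t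
  /-- the list of old `C`-codes -/
  hcs : ∀ x ∈ S.cs, ∃ l : Fin K, l.val < m ∧ ∃ u, InA c c' l u ∧ x = E.enc u

variable (E b b' c c') in
/-- The empty state satisfies the invariant with `m = 0`. -/
theorem invM2_empty : InvM2 E b b' c c' 0 St2.empty :=
  ⟨MSub_zero E _, MSub_zero E _, MSub_zero E _, MSub_zero E _, MSub_zero E _, MSub_zero E _, MSub_zero E _,
    MSub_zero E _, fun x hx => by simp [St2.empty] at hx, fun x hx => by simp [St2.empty] at hx⟩

/-- In a model the `B`-pairs are pairwise disjoint. -/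
theorem ModelD2.b_disj (hM : ModelD2 b b' c c') {i j : Fin K} {t : G} (hi : InA b b' i t) (hj : InA b b' j t) : i = j := by
  by_contra hij
  exact hM.2.2.2 i j j t t (c j) (c j) (Or.inl hij) hi hj (inA_p j) (inA_p j) rfl

/-- In a model the `C`-pairs are pairwise disjoint. -/
theorem ModelD2.c_disj (hM : ModelD2 b b' c c') {j l : Fin K} {u : G} (hj : InA c c' j u) (hl : InA c c' l u) : j = l := by
  by_contra hjl
  exact hM.2.2.2 j j l (b j) (b j) u u (Or.inr (Ne.symm hjl)) (inA_p j) (inA_p j) hj hl rfl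

/-! ### Freeness of the solution's next triple -/

section Free

variable (hM : ModelD2 b b' c c') {m : ℕ} {S : St2} (hS : InvM2 E b b' c c' m S) (im : Fin K) (him : im.val = m)
include hM hS him

/-- `b`-candidates of the `m`-th triple are not old `B`-elements … -/
theorem InvM2.bs_free {t : G} (ht : InA b b' im t) : S.BS.testBit (E.enc t) = false :=
  hS.hBS.testBit_eq_false fun ⟨i, hi, hit⟩ => by have := hM.b_disj hit ht; rw [this, him] at hi; omega

/-- … nor in `PB`. -/
theorem InvM2.pb_free {t : G} (ht : InA b b' im t) : S.PB.testBit (E.enc t) = false :=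
  hS.hPB.testBit_eq_false fun ⟨j, l, hj, hl, t₀, u, u', ht₀, hu, hu', h⟩ => by
    have hjm : im ≠ j := fun e => by rw [← e, him] at hj; omega
    exact hM.2.2.2 im j l t t₀ u u' (Or.inl hjm) ht ht₀ hu hu' (by rw [h]; abel)

/-- `c`-candidates of the `m`-th triple are not old `C`-elements … -/
theorem InvM2.cs_free {u : G} (hu : InA c c' im u) : S.CS.testBit (E.enc u) = false :=
  hS.hCS.testBit_eq_false fun ⟨l, hl, hlu⟩ => by have := hM.c_disj hu hlu; rw [← this, him] at hl; omega

/-- … nor in `PC` … -/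
theorem InvM2.pc_free {u : G} (hu : InA c c' im u) : S.PC.testBit (E.enc u) = false :=
  hS.hPC.testBit_eq_false fun ⟨j, i, hj, hi, t, u₀, t', ht, hu₀, ht', h⟩ => by
    have hjm : im ≠ j := fun e => by rw [← e, him] at hj; omega
    exact hM.2.2.2 i j im t' t u₀ u (Or.inr hjm) ht' ht hu₀ hu (by rw [h]; abel)

/-- … nor in `t + NIM` for a new `B`-element `t` (the new inner differences avoid `IN ∪ MX`). -/
theorem InvM2.nim_free {t u : G} (ht : InA b b' im t) (hu : InA c c' im u) :
    (E.g.tr S.NIM (E.enc t)).testBit (E.enc u) = false :=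
  (MSub_tr E hS.hNIM t).testBit_eq_false fun ⟨x, ⟨i, l, hi, hl, t₀, u₀, ht₀, hu₀, hx⟩, h⟩ => by
    have him' : i ≠ im := fun e => by rw [e, him] at hi; omega
    exact hM.2.2.2 i im l t₀ t u u₀ (Or.inl him') ht₀ ht hu hu₀ (by rw [h, hx]; abel)

end Free

/-! ### The literal tests pass on the solution -/

/-- `allL` is a conjunction. -/
theorem allL_eq_true {l : List ℕ} {f : ℕ → Bool} (h : ∀ x ∈ l, f x = true) : allL l f = true := by
  induction l with
  | nil => rfl
  | cons x l ih =>
      show (f x && allL l f) = true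
      rw [h x (by simp), ih (fun y hy => h y (by simp [hy]))]; rfl

/-- Bits of `dMask`: the four inner differences of the triple. -/
theorem testBit_dMask (E : GEnc G) (t₁ t₂ u₁ u₂ z : G) (h : (dMask E.g (E.enc t₁) (E.enc t₂) (E.enc u₁) (E.enc u₂)).testBit (E.enc z) = true) :
    ∃ t u, (t = t₁ ∨ t = t₂) ∧ (u = u₁ ∨ u = u₂) ∧ z = t - u := by
  have hD : MSub E (dMask E.g (E.enc t₁) (E.enc t₂) (E.enc u₁) (E.enc u₂))
      (fun z => ∃ t u, (t = t₁ ∨ t = t₂) ∧ (u = u₁ ∨ u = u₂) ∧ z = t - u) := by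
    unfold dMask
    rw [E.sub_enc, E.sub_enc, E.sub_enc, E.sub_enc]
    exact MSub_lor E (MSub_lor E (MSub_lor E (MSub_bit E ⟨t₁, u₁, Or.inl rfl, Or.inl rfl, rfl⟩)
      (MSub_bit E ⟨t₁, u₂, Or.inl rfl, Or.inr rfl, rfl⟩)) (MSub_bit E ⟨t₂, u₁, Or.inr rfl, Or.inl rfl, rfl⟩))
      (MSub_bit E ⟨t₂, u₂, Or.inr rfl, Or.inr rfl, rfl⟩)
  exact hD.2 z h

/-- THE LITERAL TESTS PASS on the `m`-th triple of a solution. -/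
theorem validNew_true (hM : ModelD2 b b' c c') {m : ℕ} {S : St2} (hS : InvM2 E b b' c c' m S) (im : Fin K)
    (him : im.val = m) : validNew E.g S (E.enc (b im)) (E.enc (b' im)) (E.enc (c im)) (E.enc (c' im)) = true := by
  unfold validNew
  rw [force_eq]
  set D := dMask E.g (E.enc (b im)) (E.enc (b' im)) (E.enc (c im)) (E.enc (c' im)) with hD
  have hDsem : ∀ z, D.testBit (E.enc z) = true → ∃ t u, InA b b' im t ∧ InA c c' im u ∧ z = t - u := fun z hz => by
    obtain ⟨t, u, ht, hu, h⟩ := testBit_dMask E _ _ _ _ z (hD ▸ hz)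
    exact ⟨t, u, ht, hu, h⟩
  have hne1 : Nat.beq (E.g.sub (E.enc (b im)) (E.enc (c im))) (E.g.sub (E.enc (b' im)) (E.enc (c' im))) = false := by
    rw [E.sub_enc, E.sub_enc]
    refine IcosetW.beq_false_of_ne fun h => hM.1 im ?_
    exact (hM.2.2.1 im (b' im) (b im) (c im) (c' im) (inA_q im) (inA_p im) (inA_p im) (inA_q im) (E.enc_inj h)).1.symm
  have hne2 : Nat.beq (E.g.sub (E.enc (b im)) (E.enc (c' im))) (E.g.sub (E.enc (b' im)) (E.enc (c im))) = false := by
    rw [E.sub_enc, E.sub_enc]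
    refine IcosetW.beq_false_of_ne fun h => hM.1 im ?_
    exact (hM.2.2.1 im (b' im) (b im) (c' im) (c im) (inA_q im) (inA_p im) (inA_q im) (inA_p im) (E.enc_inj h)).1.symm
  -- a new-`B` / old-`C` mixed difference is not a new inner difference
  have hmixC : ∀ {t u : G}, InA b b' im t → (∃ l : Fin K, l.val < m ∧ InA c c' l u) →
      D.testBit (E.g.sub (E.enc t) (E.enc u)) = false := by
    rintro t u ht ⟨l, hl, hu⟩
    have hlm : l ≠ im := fun e => by rw [e, him] at hl; omega
    rw [E.sub_enc]
    cases hb : D.testBit (E.enc (t - u))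
    · rfl
    · obtain ⟨t', u', ht', hu', h⟩ := hDsem _ hb
      exact (hM.2.2.2 im im l t t' u' u (Or.inr hlm) ht ht' hu' hu (by rw [h])).elim
  -- an old-`B` / new-`C` mixed difference is not a new inner difference
  have hmixB : ∀ {t u : G}, (∃ i : Fin K, i.val < m ∧ InA b b' i t) → InA c c' im u →
      D.testBit (E.g.sub (E.enc t) (E.enc u)) = false := by
    rintro t u ⟨i, hi, ht⟩ hu
    have him' : i ≠ im := fun e => by rw [e, him] at hi; omega
    rw [E.sub_enc]
    cases hb : D.testBit (E.enc (t - u))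
    · rfl
    · obtain ⟨t', u', ht', hu', h⟩ := hDsem _ hb
      exact (hM.2.2.2 i im im t t' u' u (Or.inl him') ht ht' hu' hu (by rw [h])).elim
  have hcs : ∀ x ∈ S.cs, (!(D.testBit (E.g.sub (E.enc (b im)) x)) && !(D.testBit (E.g.sub (E.enc (b' im)) x))) = true := by
    intro x hx
    obtain ⟨l, hl, u, hu, rfl⟩ := hS.hcs x hx
    rw [hmixC (inA_p im) ⟨l, hl, hu⟩, hmixC (inA_q im) ⟨l, hl, hu⟩]; rfl
  have hbs : ∀ x ∈ S.bs, (!(D.testBit (E.g.sub x (E.enc (c im)))) && !(D.testBit (E.g.sub x (E.enc (c' im))))) = true := by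
    intro x hx
    obtain ⟨i, hi, t, ht, rfl⟩ := hS.hbs x hx
    rw [hmixB ⟨i, hi, ht⟩ (inA_p im), hmixB ⟨i, hi, ht⟩ (inA_q im)]; rfl
  rw [hne1, hne2, allL_eq_true hcs, allL_eq_true hbs]; rfl

/-! ### The child state and its invariant -/

/-- The state built by `child2`. -/
noncomputable def childSt2 (g : GC) (S : St2) (b b' c c' : ℕ) : St2 :=
  ⟨b, Nat.lor S.IN (dMask g b b' c c'),
    Nat.lor S.MX (orL S.cs (fun u => Nat.lor (bit (g.sub b u)) (bit (g.sub b' u)))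
      (orL S.bs (fun t => Nat.lor (bit (g.sub t c)) (bit (g.sub t c'))) 0)),
    Nat.lor S.NI (ndMask g b b' c c'),
    Nat.lor (Nat.lor S.NIM (ndMask g b b' c c')) (orL S.cs (fun u => Nat.lor (bit (g.sub u b)) (bit (g.sub u b')))
      (orL S.bs (fun t => Nat.lor (bit (g.sub c t)) (bit (g.sub c' t))) 0)),
    Nat.lor (Nat.lor S.BS (bit b)) (bit b'), Nat.lor (Nat.lor S.CS (bit c)) (bit c'),
    Nat.lor (Nat.lor (orL S.cs (fun u => g.tr (dMask g b b' c c') u) S.PB) (g.tr (Nat.lor S.IN (dMask g b b' c c')) c))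
      (g.tr (Nat.lor S.IN (dMask g b b' c c')) c'),
    Nat.lor (Nat.lor (orL S.bs (fun t => g.tr (ndMask g b b' c c') t) S.PC) (g.tr (Nat.lor S.NI (ndMask g b b' c c')) b))
      (g.tr (Nat.lor S.NI (ndMask g b b' c c')) b'),
    b :: b' :: S.bs, c :: c' :: S.cs⟩

/-- `child2` unfolded. -/
theorem child2_eq (g : GC) (S : St2) (b b' c c' : ℕ) (k : St2 → Bool) :
    child2 g S b b' c c' k = k (childSt2 g S b b' c c') := by
  unfold child2; simp only [force_eq]; rfl

/-- Mask semantics of a list union. -/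
theorem MSub_orL {l : List ℕ} {f : ℕ → ℕ} {m₀ : ℕ} {P : G → Prop} (h0 : MSub E m₀ P) (hf : ∀ x ∈ l, MSub E (f x) P) :
    MSub E (orL l f m₀) P := by
  induction l with
  | nil => exact h0
  | cons x l ih =>
      show MSub E (Nat.lor (orL l f m₀) (f x)) P
      exact MSub_lor E (ih fun y hy => hf y (by simp [hy])) (hf x (by simp))

/-- Semantics of `dMask` on the codes of the `m`-th triple. -/
theorem msub_dMask (E : GEnc G) (b b' c c' : Fin K → G) (im : Fin K) :
    MSub E (dMask E.g (E.enc (b im)) (E.enc (b' im)) (E.enc (c im)) (E.enc (c' im)))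
      (fun z => ∃ t u, InA b b' im t ∧ InA c c' im u ∧ z = t - u) := by
  unfold dMask
  rw [E.sub_enc, E.sub_enc, E.sub_enc, E.sub_enc]
  exact MSub_lor E (MSub_lor E (MSub_lor E (MSub_bit E ⟨_, _, inA_p im, inA_p im, rfl⟩)
    (MSub_bit E ⟨_, _, inA_p im, inA_q im, rfl⟩)) (MSub_bit E ⟨_, _, inA_q im, inA_p im, rfl⟩))
    (MSub_bit E ⟨_, _, inA_q im, inA_q im, rfl⟩)

/-- Semantics of `ndMask` on the codes of the `m`-th triple. -/
theorem msub_ndMask (E : GEnc G) (b b' c c' : Fin K → G) (im : Fin K) :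
    MSub E (ndMask E.g (E.enc (b im)) (E.enc (b' im)) (E.enc (c im)) (E.enc (c' im)))
      (fun z => ∃ t u, InA b b' im t ∧ InA c c' im u ∧ z = u - t) := by
  unfold ndMask
  rw [E.sub_enc, E.sub_enc, E.sub_enc, E.sub_enc]
  exact MSub_lor E (MSub_lor E (MSub_lor E (MSub_bit E ⟨_, _, inA_p im, inA_p im, rfl⟩)
    (MSub_bit E ⟨_, _, inA_p im, inA_q im, rfl⟩)) (MSub_bit E ⟨_, _, inA_q im, inA_p im, rfl⟩))
    (MSub_bit E ⟨_, _, inA_q im, inA_q im, rfl⟩)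

/-- THE CHILD UPDATE: the state built from the codes of the `m`-th triple satisfies the invariant for `m + 1`. -/
theorem invM2_childSt2 {m : ℕ} (im : Fin K) (him : im.val = m) {S : St2} (hS : InvM2 E b b' c c' m S) :
    InvM2 E b b' c c' (m + 1) (childSt2 E.g S (E.enc (b im)) (E.enc (b' im)) (E.enc (c im)) (E.enc (c' im))) := by
  have hD := msub_dMask E b b' c c' im
  have hND := msub_ndMask E b b' c c' im
  have hIN2 : MSub E (Nat.lor S.IN (dMask E.g (E.enc (b im)) (E.enc (b' im)) (E.enc (c im)) (E.enc (c' im))))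
      (fun x => ∃ j : Fin K, j.val < m + 1 ∧ ∃ t u, InA b b' j t ∧ InA c c' j u ∧ x = t - u) :=
    MSub_lor' E hS.hIN hD (fun x ⟨j, hj, t, u, ht, hu, h⟩ => ⟨j, by omega, t, u, ht, hu, h⟩)
      (fun x ⟨t, u, ht, hu, h⟩ => ⟨im, by omega, t, u, ht, hu, h⟩)
  have hNI2 : MSub E (Nat.lor S.NI (ndMask E.g (E.enc (b im)) (E.enc (b' im)) (E.enc (c im)) (E.enc (c' im))))
      (fun x => ∃ j : Fin K, j.val < m + 1 ∧ ∃ t u, InA b b' j t ∧ InA c c' j u ∧ x = u - t) :=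
    MSub_lor' E hS.hNI hND (fun x ⟨j, hj, t, u, ht, hu, h⟩ => ⟨j, by omega, t, u, ht, hu, h⟩)
      (fun x ⟨t, u, ht, hu, h⟩ => ⟨im, by omega, t, u, ht, hu, h⟩)
  constructor
  · exact hIN2
  · -- MX
    refine MSub_lor' E hS.hMX (MSub_orL (MSub_orL (MSub_zero E _) fun x hx => ?_) fun x hx => ?_)
      (fun x ⟨i, l, hi, hl, hil, t, u, ht, hu, h⟩ => ⟨i, l, by omega, by omega, hil, t, u, ht, hu, h⟩) (fun _ h => h)
    · obtain ⟨i, hi, t, ht, rfl⟩ := hS.hbs x hx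
      have him' : i ≠ im := fun e => by rw [e, him] at hi; omega
      rw [E.sub_enc, E.sub_enc]
      exact MSub_lor E (MSub_bit E ⟨i, im, by omega, by omega, him', t, c im, ht, inA_p im, rfl⟩)
        (MSub_bit E ⟨i, im, by omega, by omega, him', t, c' im, ht, inA_q im, rfl⟩)
    · obtain ⟨l, hl, u, hu, rfl⟩ := hS.hcs x hx
      have hlm : im ≠ l := fun e => by rw [← e, him] at hl; omega
      rw [E.sub_enc, E.sub_enc]
      exact MSub_lor E (MSub_bit E ⟨im, l, by omega, by omega, hlm, b im, u, inA_p im, hu, rfl⟩)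
        (MSub_bit E ⟨im, l, by omega, by omega, hlm, b' im, u, inA_q im, hu, rfl⟩)
  · exact hNI2
  · -- NIM
    refine MSub_lor' E (MSub_lor' E hS.hNIM hND ?_ ?_) (MSub_orL (MSub_orL (MSub_zero E _) fun x hx => ?_) fun x hx => ?_)
      (fun _ h => h) (fun _ h => h)
    · rintro x ⟨i, l, hi, hl, t, u, ht, hu, h⟩; exact ⟨i, l, by omega, by omega, t, u, ht, hu, h⟩
    · rintro x ⟨t, u, ht, hu, h⟩; exact ⟨im, im, by omega, by omega, t, u, ht, hu, h⟩
    · obtain ⟨i, hi, t, ht, rfl⟩ := hS.hbs x hx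
      rw [E.sub_enc, E.sub_enc]
      exact MSub_lor E (MSub_bit E ⟨i, im, by omega, by omega, t, c im, ht, inA_p im, rfl⟩)
        (MSub_bit E ⟨i, im, by omega, by omega, t, c' im, ht, inA_q im, rfl⟩)
    · obtain ⟨l, hl, u, hu, rfl⟩ := hS.hcs x hx
      rw [E.sub_enc, E.sub_enc]
      exact MSub_lor E (MSub_bit E ⟨im, l, by omega, by omega, b im, u, inA_p im, hu, rfl⟩)
        (MSub_bit E ⟨im, l, by omega, by omega, b' im, u, inA_q im, hu, rfl⟩)
  · -- BS
    exact MSub_lor' E (MSub_lor' E hS.hBS (MSub_bit E (x := b im) ⟨im, by omega, inA_p im⟩)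
      (fun x ⟨i, hi, h⟩ => ⟨i, by omega, h⟩) (fun _ h => h)) (MSub_bit E (x := b' im) ⟨im, by omega, inA_q im⟩)
      (fun _ h => h) (fun _ h => h)
  · -- CS
    exact MSub_lor' E (MSub_lor' E hS.hCS (MSub_bit E (x := c im) ⟨im, by omega, inA_p im⟩)
      (fun x ⟨i, hi, h⟩ => ⟨i, by omega, h⟩) (fun _ h => h)) (MSub_bit E (x := c' im) ⟨im, by omega, inA_q im⟩)
      (fun _ h => h) (fun _ h => h)
  · -- PB
    refine MSub_lor' E (MSub_lor' E (MSub_orL (P := fun x => ∃ j l : Fin K, j.val < m + 1 ∧ l.val < m + 1 ∧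
        ∃ t u u', InA b b' j t ∧ InA c c' j u ∧ InA c c' l u' ∧ x = t - u + u') (hS.hPB.mono ?_) fun x hx => ?_)
      (MSub_tr E hIN2 (c im)) (fun _ h => h) ?_) (MSub_tr E hIN2 (c' im)) (fun _ h => h) ?_
    · rintro x ⟨j, l, hj, hl, t, u, u', ht, hu, hu', h⟩; exact ⟨j, l, by omega, by omega, t, u, u', ht, hu, hu', h⟩
    · obtain ⟨l, hl, u', hu', rfl⟩ := hS.hcs x hx
      exact (MSub_tr E hD u').mono fun z ⟨d, ⟨t, u, ht, hu, hd⟩, hz⟩ =>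
        ⟨im, l, by omega, by omega, t, u, u', ht, hu, hu', by rw [hz, hd]⟩
    · rintro z ⟨x, ⟨j, hj, t, u, ht, hu, hx⟩, rfl⟩; exact ⟨j, im, hj, by omega, t, u, c im, ht, hu, inA_p im, by rw [hx]⟩
    · rintro z ⟨x, ⟨j, hj, t, u, ht, hu, hx⟩, rfl⟩; exact ⟨j, im, hj, by omega, t, u, c' im, ht, hu, inA_q im, by rw [hx]⟩
  · -- PC
    refine MSub_lor' E (MSub_lor' E (MSub_orL (P := fun x => ∃ j i : Fin K, j.val < m + 1 ∧ i.val < m + 1 ∧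
        ∃ t u t', InA b b' j t ∧ InA c c' j u ∧ InA b b' i t' ∧ x = t' - (t - u)) (hS.hPC.mono ?_) fun x hx => ?_)
      (MSub_tr E hNI2 (b im)) (fun _ h => h) ?_) (MSub_tr E hNI2 (b' im)) (fun _ h => h) ?_
    · rintro x ⟨j, i, hj, hi, t, u, t', ht, hu, ht', h⟩; exact ⟨j, i, by omega, by omega, t, u, t', ht, hu, ht', h⟩
    · obtain ⟨i, hi, t', ht', rfl⟩ := hS.hbs x hx
      exact (MSub_tr E hND t').mono fun z ⟨d, ⟨t, u, ht, hu, hd⟩, hz⟩ =>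
        ⟨im, i, by omega, by omega, t, u, t', ht, hu, ht', by rw [hz, hd]; abel⟩
    · rintro z ⟨x, ⟨j, hj, t, u, ht, hu, hx⟩, rfl⟩
      exact ⟨j, im, hj, by omega, t, u, b im, ht, hu, inA_p im, by rw [hx]; abel⟩
    · rintro z ⟨x, ⟨j, hj, t, u, ht, hu, hx⟩, rfl⟩
      exact ⟨j, im, hj, by omega, t, u, b' im, ht, hu, inA_q im, by rw [hx]; abel⟩
  · -- bs
    intro x hx
    simp only [childSt2, List.mem_cons] at hx
    rcases hx with rfl | rfl | hx
    · exact ⟨im, by omega, b im, inA_p im, rfl⟩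
    · exact ⟨im, by omega, b' im, inA_q im, rfl⟩
    · obtain ⟨i, hi, t, ht, h⟩ := hS.hbs x hx; exact ⟨i, by omega, t, ht, h⟩
  · -- cs
    intro x hx
    simp only [childSt2, List.mem_cons] at hx
    rcases hx with rfl | rfl | hx
    · exact ⟨im, by omega, c im, inA_p im, rfl⟩
    · exact ⟨im, by omega, c' im, inA_q im, rfl⟩
    · obtain ⟨l, hl, u, hu, h⟩ := hS.hcs x hx; exact ⟨l, by omega, u, hu, h⟩

end Refl

end STPP122Neg

end Summit.MatrixMultiplication.OmegaCensus
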